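import Summits.NavierStokesRegularity.NavierStokesRegularity.Theorems.CertifiedBlowupCertifiedBlowupAxisymBlowupTimeShift
import Summits.NavierStokesRegularity.NavierStokesRegularity.Theorems.CertifiedBlowupCertifiedBlowupAxisymBlowupEnstrophyRate
import Literature.Analysis.FluidPDE.ConstantinDirectionDissipationProofs
import HarnessLib

/-!
# Crux `CertifiedBlowupAxisymBlowup` (stmt-NavierStokesRegularity-0727): THE ENERGY DRAIN LAW — the dissipation
# tail `ν∫_t^T∫|∇u|²` of a witness is squeezed between `c ν^{5/2} √(T − t)` and `E(u t) − E_∞ → 0`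

Theorems file landed `--supports stmt-NavierStokesRegularity-0727` (cell `ns-blowup`, GROUP B zone Z1; item (w4) «late
dissipation budget on the shift» named in the g15 FINAL §, in its two-sided form). A witness of the crux is `(ν, T, u, p)`
with the six binders `0 < ν`, `0 < T`, `IsMaximalSmoothSolution ν 0 u p T`, `IsLerayHopfOn T ν 0 (u 0) u`,
`HasRapidSpatialDecay (u 0)`, `IsAxisymmetric (u 0)`. Write `E(v) = ½∫|v|²` (`VectorCalculus.kineticEnergy`) and
`D(t₁, t₂) = ∫_{t₁}^{t₂}∫|∇u(τ, x)|²_F dx dτ` (lower Lebesgue integral of the Frobenius norm of the classical gradient).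

CAP (decay-free; every classical Leray–Hopf solution on `[0, T) × ℝ³`, `ν > 0`):
* `dissipation_le_energy_sub` — for `0 ≤ t₁ ≤ t₂ ≤ T`: `D(t₁, t₂) < ∞` and `ν D(t₁, t₂) ≤ E(u t₁) − E(u t₂)`, the final
  time `t₂ = T` INCLUDED (`u T` is the terminal slice carried by the Leray–Hopf structure). The tree's
  `IsLerayHopfOn.lintegral_frobeniusNormSq_fderiv_of_classical` is the case `t₁ = 0` with `E(u T) ≥ 0` discarded; the
  window form restarts the Leray–Hopf structure at `t₁` by the g15 time shift `TimeShift.isLerayHopfOn_shift` (right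
  `L²`-continuity at `t₁` only) and identifies its weak gradient with `∇u` (uniqueness of weak gradients);
* `kineticEnergy_antitoneOn` — `t ↦ E(u t)` is antitone on `[0, T]`.

FLOOR (CORE form over Leray's enstrophy rate `(R_c)`: `c ν^{3/2}/√(T − t) ≤ ∫|∇u(t)|²_F` on `[0, T)`, then WITNESS form
with the absolute constant of `enstrophy_rate_of_isMaximalSmoothSolution`, Leray 1934 §20 (3.12)):
* `window_dissipation_ge_of_rate` — `2c ν^{3/2}(√(T − t₁) − √(T − t₂)) ≤ D(t₁, t₂)` for `0 ≤ t₁ < t₂ ≤ T` (the rate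
  integrated EXACTLY: `lintegral_div_sqrt_sub_eq`, `∫_{t₁}^{t₂} (T − τ)^{−1/2} dτ = 2(√(T − t₁) − √(T − t₂))`);
* **`energy_sub_ge_of_rate` / `witness_energy_sub_ge` (THE DRAIN LAW)** —
  `2c ν^{5/2}(√(T − t₁) − √(T − t₂)) ≤ E(u t₁) − E(u t₂)` for `0 ≤ t₁ < t₂ ≤ T`, i.e. `E(u t) − 2c ν^{5/2}√(T − t)` is
  non-increasing on `[0, T]`; in particular (`t₂ = T`) **`2c ν^{5/2} √(T − t) ≤ E(u t) − E(u T) ≤ E(u t)`** for every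
  `t ∈ [0, T)` (`energy_sub_terminal_ge_of_rate`, `witness_kineticEnergy_ge_sqrt`) — the all-time form of the tree's
  lifespan cap `lifespan_upper_bound_of_isMaximalSmoothSolution` (`t = 0`);
* `kineticEnergy_strictAntiOn_of_rate` / `witness_kineticEnergy_strictAntiOn` — the energy of a witness is STRICTLY
  decreasing on `[0, T]` (no energy plateau on any late window);
* **`witness_energy_limit`** — there is `E_∞ ∈ [E(u T), E(u t)]` with `E(u t) → E_∞` as `t → T⁻` and
  **`2c ν^{5/2} √(T − t) ≤ E(u t) − E_∞`** for every `t ∈ [0, T)`: the last `2c ν^{5/2} √(T − t)` of kinetic energy above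
  the terminal level is dissipated inside `[t, T)` and `E(u t) − E_∞ → 0`; for the tail itself the window floor and
  the CAP give `2c ν^{5/2}√(T − t) ≤ ν D(t, T) ≤ E(u t) − E(u T)`.

ZONE-Z1 READING (K-audit hook for any candidate run printing an energy curve `E(t)` and a claimed blow-up time `T`): the
dimensionless drain `(E(t) − E(T⁻))/(ν^{5/2}√(T − t))` is bounded BELOW by an absolute constant on the whole of `[0, T)`;
a curve that plateaus (to printed precision) on a late window, or whose drain ratio tends to `0`, is outside the crux class.
The constant `c` is Leray's (that of `enstrophy_rate_of_isMaximalSmoothSolution`, from Robinson–Rodrigo–Sadowski's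
Cor. 6.9) and is not made explicit; no hand constants. No new definitions, no named-fact hypotheses, no `sorry`. WHAT THIS IS NOT: not a blow-up or
regularity claim — a priori inequalities about a HYPOTHETICAL witness of the crux class; cruxes 0727/8639/8640, the floor
`√3/4` and (AX-L) are untouched. Author: ns-blowup-profile-eng-1 g17, 2026-08-27.

## References
* J. Leray, *Sur le mouvement d'un liquide visqueux emplissant l'espace*, Acta Math. 63 (1934), §20 (3.12) p. 225,
  §31 (5.1)–(5.2), §34 p. 245. [Leray1934]
* J. C. Robinson, J. L. Rodrigo, W. Sadowski, *The Three-Dimensional Navier–Stokes Equations*, CUP 2016, Def. 4.9,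
  Cor. 4.8, Cor. 6.9, Lemma 6.14. [RobinsonRodrigoSadowski2016]
* P. Constantin, Comm. Math. Phys. 129 (1990), §2 eq. (2.21). [Constantin1990]
-/

-- the summit and its single problem share the name (D-0017 nested layout)
set_option linter.dupNamespace false

noncomputable section

open MeasureTheory Set Function Filter Topology Metric
open scoped ENNReal NNReal

namespace Summit.NavierStokesRegularity.NavierStokesRegularity.Theorems.CertifiedBlowupAxisymBlowup.EnergyDrain

open Literature.Analysis.FluidPDE
open Summit.NavierStokesRegularity.NavierStokesRegularity.Theorems.CertifiedBlowupAxisymBlowup.CompactAmplification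
open Summit.NavierStokesRegularity.NavierStokesRegularity.Theorems.CertifiedBlowupAxisymBlowup.TimeShift

variable {ν T : ℝ} {u : ℝ → EuclideanSpace ℝ (Fin 3) → EuclideanSpace ℝ (Fin 3)}
  {p : ℝ → EuclideanSpace ℝ (Fin 3) → ℝ}

/-! ### CAP: the dissipation through the classical gradient is paid by the energy drop (decay-free) -/

/-- **Dissipation from the origin is paid by the energy drop.** For a classical solution `(v, q)` on `[0, T′) × ℝ³` which
is Leray–Hopf on `[0, T′)` from `v₀` and every `t ∈ [0, T′]`: `∫₀ᵗ∫|∇v|²_F < ∞` and `ν ∫₀ᵗ∫|∇v|²_F ≤ E(v₀) − E(v t)` —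
the energy inequality of the structure from `s = 0` (force `0`), with its weak gradient `G` identified with `∇v(τ)` for
a.e. `τ` (uniqueness of weak gradients, `HasWeakFDerivOn.unique_holds`). The tree's
`IsLerayHopfOn.lintegral_frobeniusNormSq_fderiv_of_classical` is `t = T′` with `E(v T′) ≥ 0` discarded.
[cite: Constantin1990, §2 eq. (2.21); Leray1934, §31 (5.2)] -/
theorem dissipation_le_energy_sub_zero {T' : ℝ} {v : ℝ → EuclideanSpace ℝ (Fin 3) → EuclideanSpace ℝ (Fin 3)}
    {q : ℝ → EuclideanSpace ℝ (Fin 3) → ℝ} {v₀ : EuclideanSpace ℝ (Fin 3) → EuclideanSpace ℝ (Fin 3)}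
    (hcl : IsClassicalNSSolutionOn (Ico 0 T') ν 0 v q) (hLH : IsLerayHopfOn T' ν 0 v₀ v) :
    ∀ t ∈ Icc 0 T',
      (∫⁻ τ in Ioo 0 t, ∫⁻ x, ENNReal.ofReal (frobeniusNormSq (fderiv ℝ (v τ) x))) ≠ ∞ ∧
      ν * (∫⁻ τ in Ioo 0 t, ∫⁻ x, ENNReal.ofReal (frobeniusNormSq (fderiv ℝ (v τ) x))).toReal ≤
        VectorCalculus.kineticEnergy v₀ - VectorCalculus.kineticEnergy (v t) := by
  -- adapted from the tree's `IsLerayHopfOn.lintegral_frobeniusNormSq_fderiv_of_classical`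
  obtain ⟨G, hG, hGfin, hE0, -⟩ := hLH.weakGrad_energy
  intro t ht
  have hsub : Ioo 0 t ⊆ Ioo 0 T' := Ioo_subset_Ioo_right ht.2
  have hae : ∀ᵐ τ ∂(volume.restrict (Ioo 0 t)), (∫⁻ x, ENNReal.ofReal (frobeniusNormSq (G τ x))) =
      ∫⁻ x, ENNReal.ofReal (frobeniusNormSq (fderiv ℝ (v τ) x)) := by
    filter_upwards [ae_restrict_of_ae_restrict_of_subset hsub hG, ae_restrict_mem measurableSet_Ioo]
      with τ hGτ hτ
    have hτ' : τ ∈ Ico 0 T' := ⟨hτ.1.le, lt_of_lt_of_le hτ.2 ht.2⟩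
    have hu1 : ContDiff ℝ 1 (v τ) := (hcl.contDiff_velocity hτ').of_le (by exact_mod_cast le_top)
    have heq : G τ =ᵐ[volume] fderiv ℝ (v τ) := by
      have := Literature.Analysis.FunctionSpaces.HasWeakFDerivOn.unique_holds hGτ (hasWeakGradient_fderiv_of_contDiff hu1)
      simpa [Measure.restrict_univ] using this
    refine lintegral_congr_ae ?_
    filter_upwards [heq] with x hx
    rw [hx]
  have hEq : (∫⁻ τ in Ioo 0 t, ∫⁻ x, ENNReal.ofReal (frobeniusNormSq (G τ x))) =
      ∫⁻ τ in Ioo 0 t, ∫⁻ x, ENNReal.ofReal (frobeniusNormSq (fderiv ℝ (v τ) x)) :=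
    lintegral_congr_ae hae
  have hfin : (∫⁻ τ in Ioo 0 t, ∫⁻ x, ENNReal.ofReal (frobeniusNormSq (G τ x))) ≠ ∞ :=
    (lt_of_le_of_lt (lintegral_mono_set hsub) hGfin).ne
  have h := hE0 t ht
  simp only [Pi.zero_apply, inner_zero_left, integral_zero, intervalIntegral.integral_zero,
    add_zero] at h
  rw [← hEq]
  exact ⟨hfin, by linarith⟩

/-- **THE CAP: dissipation on a window is paid by the energy drop across it — the final time included.** For a classical
solution on `[0, T) × ℝ³`, `ν > 0`, Leray–Hopf on `[0, T)` from `u 0`, and `0 ≤ t₁ ≤ t₂ ≤ T`: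
`∫_{t₁}^{t₂}∫|∇u|²_F < ∞` and `ν ∫_{t₁}^{t₂}∫|∇u|²_F ≤ E(u t₁) − E(u t₂)`. For `t₁ > 0` the Leray–Hopf structure is
restarted at `t₁` with the full horizon (`TimeShift.isLerayHopfOn_shift`: right `L²`-continuity at `t₁` only, the
blow-up time is never touched) and `dissipation_le_energy_sub_zero` is applied to the translate `u(· + t₁)`; NO decay and
NO symmetry hypothesis. [cite: RobinsonRodrigoSadowski2016, Def. 4.9 and Cor. 4.8; Constantin1990, §2 eq. (2.21)] -/
theorem dissipation_le_energy_sub (hν : 0 < ν) (hcl : IsClassicalNSSolutionOn (Ico 0 T) ν 0 u p)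
    (hLH : IsLerayHopfOn T ν 0 (u 0) u) {t₁ t₂ : ℝ} (ht₁ : 0 ≤ t₁) (h12 : t₁ ≤ t₂) (ht₂ : t₂ ≤ T) :
    (∫⁻ τ in Ioo t₁ t₂, ∫⁻ x, ENNReal.ofReal (frobeniusNormSq (fderiv ℝ (u τ) x))) ≠ ∞ ∧
      ν * (∫⁻ τ in Ioo t₁ t₂, ∫⁻ x, ENNReal.ofReal (frobeniusNormSq (fderiv ℝ (u τ) x))).toReal ≤
        VectorCalculus.kineticEnergy (u t₁) - VectorCalculus.kineticEnergy (u t₂) := by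
  rcases ht₁.eq_or_lt with h0 | h0
  · -- `t₁ = 0`: the structure itself
    subst h0
    exact dissipation_le_energy_sub_zero hcl hLH t₂ ⟨h12, ht₂⟩
  rcases le_or_gt T t₁ with hTt₁ | ht₁T
  · -- degenerate window `t₁ = t₂ = T`
    have h12' : t₁ = t₂ := le_antisymm h12 (ht₂.trans hTt₁)
    subst h12'
    rw [Ioo_self, Measure.restrict_empty, lintegral_zero_measure]
    exact ⟨ENNReal.zero_ne_top, by simp⟩
  -- `0 < t₁ < T`: restart the Leray–Hopf structure at `t₁` (g15 time shift) and translate the classical solution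
  have hLH' := isLerayHopfOn_shift hν hcl hLH h0 ht₁T
  have hcl' := hcl.translate_Ico_zero ht₁
  have h := dissipation_le_energy_sub_zero hcl' hLH' (t₂ - t₁) ⟨sub_nonneg.2 h12, sub_le_sub_right ht₂ _⟩
  have hcv : (∫⁻ τ in Ioo 0 (t₂ - t₁), ∫⁻ x, ENNReal.ofReal (frobeniusNormSq (fderiv ℝ (u (τ + t₁)) x))) =
      ∫⁻ τ in Ioo t₁ t₂, ∫⁻ x, ENNReal.ofReal (frobeniusNormSq (fderiv ℝ (u τ) x)) := by
    simpa only [zero_add, sub_add_cancel] using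
      setLIntegral_Ioo_comp_add_right (fun τ => ∫⁻ x, ENNReal.ofReal (frobeniusNormSq (fderiv ℝ (u τ) x)))
        0 (t₂ - t₁) t₁
  rw [hcv, sub_add_cancel] at h
  exact h

/-- **The energy of a classical Leray–Hopf solution is antitone on `[0, T]`, the final time included**
(`ν > 0`; no decay, no symmetry): `E(u t₂) ≤ E(u t₁)` for `0 ≤ t₁ ≤ t₂ ≤ T`, since the dissipation is nonnegative.
[cite: Leray1934, §31 (5.1)–(5.2)] -/
theorem kineticEnergy_antitoneOn (hν : 0 < ν) (hcl : IsClassicalNSSolutionOn (Ico 0 T) ν 0 u p)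
    (hLH : IsLerayHopfOn T ν 0 (u 0) u) :
    AntitoneOn (fun t => VectorCalculus.kineticEnergy (u t)) (Icc 0 T) := by
  intro t₁ ht₁ t₂ ht₂ h12
  have h := (dissipation_le_energy_sub hν hcl hLH ht₁.1 h12 ht₂.2).2
  have h0 : 0 ≤ ν * (∫⁻ τ in Ioo t₁ t₂, ∫⁻ x, ENNReal.ofReal (frobeniusNormSq (fderiv ℝ (u τ) x))).toReal :=
    mul_nonneg hν.le ENNReal.toReal_nonneg
  show VectorCalculus.kineticEnergy (u t₂) ≤ VectorCalculus.kineticEnergy (u t₁)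
  linarith

/-! ### FLOOR, CORE form: over Leray's enstrophy rate `(R_c)` on `[0, T)` -/

/-- `ν · ν^{3/2} = ν^{5/2}` for `ν > 0`. [folklore] -/
theorem mul_rpow_three_halves (hν : 0 < ν) : ν * ν ^ (3 / 2 : ℝ) = ν ^ (5 / 2 : ℝ) := by
  rw [show (5 / 2 : ℝ) = 1 + 3 / 2 by norm_num, Real.rpow_add hν, Real.rpow_one]

/-- **The exact tail integral of Leray's rate**: for `t₁ < t₂ ≤ T` and `A ≥ 0`,
`∫_{t₁}^{t₂} A/√(T − τ) dτ = 2A(√(T − t₁) − √(T − t₂))` (as a lower Lebesgue integral of `ofReal`; substitution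
`x = T − τ` and `∫ x^{−1/2} = 2x^{1/2}`, Mathlib `integral_rpow`). [folklore] -/
theorem lintegral_div_sqrt_sub_eq {A t₁ t₂ : ℝ} (hA : 0 ≤ A) (h12 : t₁ < t₂) (ht₂ : t₂ ≤ T) :
    ∫⁻ τ in Ioo t₁ t₂, ENNReal.ofReal (A / Real.sqrt (T - τ)) =
      ENNReal.ofReal (2 * A * (Real.sqrt (T - t₁) - Real.sqrt (T - t₂))) := by
  set r : ℝ := -(1 / 2 : ℝ) with hr
  have hr1 : (-1 : ℝ) < r := by rw [hr]; norm_num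
  -- the model integrand `A (T − τ)^r` agrees with `A/√(T − τ)` on the window
  have heq : ∀ τ ∈ Ioo t₁ t₂, A * (T - τ) ^ r = A / Real.sqrt (T - τ) := by
    intro τ hτ
    have hTτ : 0 ≤ T - τ := by linarith [hτ.2]
    rw [hr, Real.rpow_neg hTτ, ← Real.sqrt_eq_rpow, div_eq_mul_inv]
  -- integrability of the model integrand on the window
  have hii : IntervalIntegrable (fun τ : ℝ => A * (T - τ) ^ r) volume t₁ t₂ := by
    have h1 : IntervalIntegrable (fun x : ℝ => x ^ r) volume (T - t₂) (T - t₁) :=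
      intervalIntegral.intervalIntegrable_rpow' hr1
    have h2 : IntervalIntegrable (fun x : ℝ => (T - x) ^ r) volume (T - (T - t₂)) (T - (T - t₁)) :=
      h1.comp_sub_left T
    simp only [sub_sub_cancel] at h2
    exact h2.symm.const_mul A
  have hint : IntegrableOn (fun τ : ℝ => A * (T - τ) ^ r) (Ioo t₁ t₂) :=
    ((intervalIntegrable_iff_integrableOn_Ioc_of_le h12.le).1 hii).mono_set Ioo_subset_Ioc_self
  have hnn : 0 ≤ᵐ[volume.restrict (Ioo t₁ t₂)] fun τ : ℝ => A * (T - τ) ^ r := by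
    rw [EventuallyLE, ae_restrict_iff' measurableSet_Ioo]
    exact Eventually.of_forall fun τ hτ => mul_nonneg hA (Real.rpow_nonneg (by linarith [hτ.2]) _)
  -- the exact value of the model integral
  have hsub : ∫ τ in t₁..t₂, (T - τ) ^ r = ∫ x in (T - t₂)..(T - t₁), x ^ r :=
    intervalIntegral.integral_comp_sub_left (fun x : ℝ => x ^ r) T
  have hval : ∫ τ in Ioo t₁ t₂, A * (T - τ) ^ r = 2 * A * (Real.sqrt (T - t₁) - Real.sqrt (T - t₂)) := by
    rw [← integral_Ioc_eq_integral_Ioo, ← intervalIntegral.integral_of_le h12.le,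
      intervalIntegral.integral_const_mul, hsub, integral_rpow (Or.inl hr1), Real.sqrt_eq_rpow,
      Real.sqrt_eq_rpow, hr]
    norm_num
    ring
  -- assemble
  have hof : ENNReal.ofReal (∫ τ in Ioo t₁ t₂, A * (T - τ) ^ r) =
      ∫⁻ τ in Ioo t₁ t₂, ENNReal.ofReal (A * (T - τ) ^ r) :=
    ofReal_integral_eq_lintegral_ofReal hint hnn
  rw [← hval, hof]
  exact setLIntegral_congr_fun measurableSet_Ioo fun τ hτ => by rw [heq τ hτ]

/-- **Window dissipation floor (exact).** If `c ν^{3/2}/√(T − t) ≤ ∫|∇u(t)|²_F` for every `t ∈ [0, T)` (Leray's rate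
`(R_c)`), then for `0 ≤ t₁ < t₂ ≤ T`: `2c ν^{3/2}(√(T − t₁) − √(T − t₂)) ≤ ∫_{t₁}^{t₂}∫|∇u|²_F` — the rate integrated
exactly over the window (`lintegral_div_sqrt_sub_eq`). [cite: Leray1934, §20 (3.12) p. 225] -/
theorem window_dissipation_ge_of_rate (hν : 0 < ν) {c : ℝ} (hc : 0 ≤ c)
    (hler : ∀ t ∈ Ico 0 T, ENNReal.ofReal (c * ν ^ (3 / 2 : ℝ) / Real.sqrt (T - t)) ≤
      ∫⁻ x, ENNReal.ofReal (frobeniusNormSq (fderiv ℝ (u t) x)))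
    {t₁ t₂ : ℝ} (ht₁ : 0 ≤ t₁) (h12 : t₁ < t₂) (ht₂ : t₂ ≤ T) :
    ENNReal.ofReal (2 * (c * ν ^ (3 / 2 : ℝ)) * (Real.sqrt (T - t₁) - Real.sqrt (T - t₂))) ≤
      ∫⁻ τ in Ioo t₁ t₂, ∫⁻ x, ENNReal.ofReal (frobeniusNormSq (fderiv ℝ (u τ) x)) := by
  have hA0 : 0 ≤ c * ν ^ (3 / 2 : ℝ) := by positivity
  rw [← lintegral_div_sqrt_sub_eq hA0 h12 ht₂]
  exact setLIntegral_mono' measurableSet_Ioo fun τ hτ =>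
    hler τ ⟨ht₁.trans hτ.1.le, lt_of_lt_of_le hτ.2 ht₂⟩

/-- **THE DRAIN LAW (CORE form).** For a classical solution on `[0, T) × ℝ³`, `ν > 0`, Leray–Hopf on `[0, T)` from `u 0`,
obeying Leray's rate `(R_c)` on `[0, T)`, and `0 ≤ t₁ < t₂ ≤ T` (the final time included):
`2c ν^{5/2}(√(T − t₁) − √(T − t₂)) ≤ E(u t₁) − E(u t₂)` — the window floor `window_dissipation_ge_of_rate` against the
cap `dissipation_le_energy_sub`; equivalently `t ↦ E(u t) − 2c ν^{5/2}√(T − t)` is non-increasing on `[0, T]`.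
[cite: Leray1934, §20 (3.12) and §31 (5.2)] -/
theorem energy_sub_ge_of_rate (hν : 0 < ν) (hcl : IsClassicalNSSolutionOn (Ico 0 T) ν 0 u p)
    (hLH : IsLerayHopfOn T ν 0 (u 0) u) {c : ℝ} (hc : 0 ≤ c)
    (hler : ∀ t ∈ Ico 0 T, ENNReal.ofReal (c * ν ^ (3 / 2 : ℝ) / Real.sqrt (T - t)) ≤
      ∫⁻ x, ENNReal.ofReal (frobeniusNormSq (fderiv ℝ (u t) x)))
    {t₁ t₂ : ℝ} (ht₁ : 0 ≤ t₁) (h12 : t₁ < t₂) (ht₂ : t₂ ≤ T) :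
    2 * c * ν ^ (5 / 2 : ℝ) * (Real.sqrt (T - t₁) - Real.sqrt (T - t₂)) ≤
      VectorCalculus.kineticEnergy (u t₁) - VectorCalculus.kineticEnergy (u t₂) := by
  obtain ⟨hfin, hcap⟩ := dissipation_le_energy_sub hν hcl hLH ht₁ h12.le ht₂
  have hfloor := window_dissipation_ge_of_rate hν hc hler ht₁ h12 ht₂
  have hreal : 2 * (c * ν ^ (3 / 2 : ℝ)) * (Real.sqrt (T - t₁) - Real.sqrt (T - t₂)) ≤
      (∫⁻ τ in Ioo t₁ t₂, ∫⁻ x, ENNReal.ofReal (frobeniusNormSq (fderiv ℝ (u τ) x))).toReal :=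
    (ENNReal.ofReal_le_iff_le_toReal hfin).1 hfloor
  have h := (mul_le_mul_of_nonneg_left hreal hν.le).trans hcap
  calc 2 * c * ν ^ (5 / 2 : ℝ) * (Real.sqrt (T - t₁) - Real.sqrt (T - t₂))
      = ν * (2 * (c * ν ^ (3 / 2 : ℝ)) * (Real.sqrt (T - t₁) - Real.sqrt (T - t₂))) := by
        rw [← mul_rpow_three_halves hν]; ring
    _ ≤ _ := h

/-- **Energy floor above the terminal slice (CORE form).** In the setting of `energy_sub_ge_of_rate`, for every
`t ∈ [0, T)`: `2c ν^{5/2} √(T − t) ≤ E(u t) − E(u T)`, where `u T` is the terminal slice carried by the Leray–Hopf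
structure on `[0, T]` (take `t₂ = T`). [cite: Leray1934, §20 (3.12) and §34 p. 245] -/
theorem energy_sub_terminal_ge_of_rate (hν : 0 < ν) (hcl : IsClassicalNSSolutionOn (Ico 0 T) ν 0 u p)
    (hLH : IsLerayHopfOn T ν 0 (u 0) u) {c : ℝ} (hc : 0 ≤ c)
    (hler : ∀ t ∈ Ico 0 T, ENNReal.ofReal (c * ν ^ (3 / 2 : ℝ) / Real.sqrt (T - t)) ≤
      ∫⁻ x, ENNReal.ofReal (frobeniusNormSq (fderiv ℝ (u t) x)))
    {t : ℝ} (ht : t ∈ Ico 0 T) :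
    2 * c * ν ^ (5 / 2 : ℝ) * Real.sqrt (T - t) ≤
      VectorCalculus.kineticEnergy (u t) - VectorCalculus.kineticEnergy (u T) := by
  have h := energy_sub_ge_of_rate hν hcl hLH hc hler ht.1 ht.2 le_rfl
  rwa [sub_self, Real.sqrt_zero, sub_zero] at h

/-- **Energy floor (CORE form): `2c ν^{5/2} √(T − t) ≤ E(u t)` for every `t ∈ [0, T)`** — the terminal energy is
nonnegative. The case `t = 0` is the tree's lifespan cap `lifespan_upper_bound_of_isMaximalSmoothSolution`
(`ν⁵ T ≤ C E(u 0)²`); here it holds at EVERY time, with no decay hypothesis at `t`. [cite: Leray1934, §34 p. 245] -/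
theorem kineticEnergy_ge_sqrt_of_rate (hν : 0 < ν) (hcl : IsClassicalNSSolutionOn (Ico 0 T) ν 0 u p)
    (hLH : IsLerayHopfOn T ν 0 (u 0) u) {c : ℝ} (hc : 0 ≤ c)
    (hler : ∀ t ∈ Ico 0 T, ENNReal.ofReal (c * ν ^ (3 / 2 : ℝ) / Real.sqrt (T - t)) ≤
      ∫⁻ x, ENNReal.ofReal (frobeniusNormSq (fderiv ℝ (u t) x)))
    {t : ℝ} (ht : t ∈ Ico 0 T) :
    2 * c * ν ^ (5 / 2 : ℝ) * Real.sqrt (T - t) ≤ VectorCalculus.kineticEnergy (u t) := by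
  have h := energy_sub_terminal_ge_of_rate hν hcl hLH hc hler ht
  linarith [kineticEnergy_nonneg (u T)]

/-- **No energy plateau (CORE form):** under `(R_c)` with `c > 0`, `t ↦ E(u t)` is STRICTLY decreasing on `[0, T]`
(the final time included). [cite: Leray1934, §20 (3.12) and §31 (5.2)] -/
theorem kineticEnergy_strictAntiOn_of_rate (hν : 0 < ν) (hcl : IsClassicalNSSolutionOn (Ico 0 T) ν 0 u p)
    (hLH : IsLerayHopfOn T ν 0 (u 0) u) {c : ℝ} (hc : 0 < c)
    (hler : ∀ t ∈ Ico 0 T, ENNReal.ofReal (c * ν ^ (3 / 2 : ℝ) / Real.sqrt (T - t)) ≤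
      ∫⁻ x, ENNReal.ofReal (frobeniusNormSq (fderiv ℝ (u t) x))) :
    StrictAntiOn (fun t => VectorCalculus.kineticEnergy (u t)) (Icc 0 T) := by
  intro t₁ ht₁ t₂ ht₂ h12
  have h := energy_sub_ge_of_rate hν hcl hLH hc.le hler ht₁.1 h12 ht₂.2
  have hsq : 0 < Real.sqrt (T - t₁) - Real.sqrt (T - t₂) :=
    sub_pos.2 (Real.sqrt_lt_sqrt (by linarith [ht₂.2]) (by linarith))
  have hpos : 0 < 2 * c * ν ^ (5 / 2 : ℝ) * (Real.sqrt (T - t₁) - Real.sqrt (T - t₂)) := by positivity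
  show VectorCalculus.kineticEnergy (u t₂) < VectorCalculus.kineticEnergy (u t₁)
  linarith

/-- **The limit energy (CORE form).** Under `(R_c)`, `c ≥ 0`, `T > 0`: there is `E_∞` with `E(u T) ≤ E_∞ ≤ E(u t)` for
all `t ∈ [0, T)`, `E(u t) → E_∞` as `t → T⁻` (antitone and bounded below: `AntitoneOn.tendsto_nhdsWithin_Ioo_left`,
`E_∞ = inf_{(0,T)} E(u ·)`), and **`2c ν^{5/2} √(T − t) ≤ E(u t) − E_∞`** for every `t ∈ [0, T)` (let `t₂ → T⁻` in the
drain law; `√(T − t₂) → 0`). [cite: Leray1934, §20 (3.12) and §31 (5.2)] -/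
theorem energy_limit_of_rate (hν : 0 < ν) (hT : 0 < T) (hcl : IsClassicalNSSolutionOn (Ico 0 T) ν 0 u p)
    (hLH : IsLerayHopfOn T ν 0 (u 0) u) {c : ℝ} (hc : 0 ≤ c)
    (hler : ∀ t ∈ Ico 0 T, ENNReal.ofReal (c * ν ^ (3 / 2 : ℝ) / Real.sqrt (T - t)) ≤
      ∫⁻ x, ENNReal.ofReal (frobeniusNormSq (fderiv ℝ (u t) x))) :
    ∃ Einf : ℝ, VectorCalculus.kineticEnergy (u T) ≤ Einf ∧
      (∀ t ∈ Ico 0 T, Einf ≤ VectorCalculus.kineticEnergy (u t)) ∧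
      Tendsto (fun t => VectorCalculus.kineticEnergy (u t)) (𝓝[<] T) (𝓝 Einf) ∧
      ∀ t ∈ Ico 0 T, 2 * c * ν ^ (5 / 2 : ℝ) * Real.sqrt (T - t) ≤ VectorCalculus.kineticEnergy (u t) - Einf := by
  set E : ℝ → ℝ := fun t => VectorCalculus.kineticEnergy (u t) with hE
  have hanti := kineticEnergy_antitoneOn hν hcl hLH
  have hne : (Ioo 0 T).Nonempty := nonempty_Ioo.2 hT
  -- `E(u T)` is a lower bound of the energies on `(0, T)`
  have hlow : ∀ b ∈ E '' Ioo 0 T, E T ≤ b := by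
    rintro b ⟨s, hs, rfl⟩
    exact hanti ⟨hs.1.le, hs.2.le⟩ ⟨hT.le, le_rfl⟩ hs.2.le
  have hbdd : BddBelow (E '' Ioo 0 T) := ⟨E T, hlow⟩
  have hanti' : AntitoneOn E (Ioo 0 T) := hanti.mono fun s hs => ⟨hs.1.le, hs.2.le⟩
  have hlim : Tendsto E (𝓝[<] T) (𝓝 (sInf (E '' Ioo 0 T))) :=
    hanti'.tendsto_nhdsWithin_Ioo_left hne hbdd
  refine ⟨sInf (E '' Ioo 0 T), le_csInf (hne.image E) hlow, fun t ht => ?_, hlim, fun t ht => ?_⟩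
  · -- `E_∞ ≤ E(u t)`: compare with a time in `(t, T) ⊆ (0, T)`
    have hs : (t + T) / 2 ∈ Ioo 0 T := ⟨by linarith [ht.1], by linarith [ht.2]⟩
    exact (csInf_le hbdd (mem_image_of_mem E hs)).trans
      (hanti ⟨ht.1, ht.2.le⟩ ⟨hs.1.le, hs.2.le⟩ (by linarith [ht.2]))
  · -- the drain law from `t` to `t₂`, then `t₂ → T⁻`
    set K : ℝ := 2 * c * ν ^ (5 / 2 : ℝ) with hK
    have hev : ∀ᶠ t₂ in 𝓝[<] T, K * (Real.sqrt (T - t) - Real.sqrt (T - t₂)) + E t₂ ≤ E t := by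
      filter_upwards [Ioo_mem_nhdsLT ht.2] with t₂ ht₂
      have h := energy_sub_ge_of_rate hν hcl hLH hc hler ht.1 ht₂.1 ht₂.2.le
      show 2 * c * ν ^ (5 / 2 : ℝ) * (Real.sqrt (T - t) - Real.sqrt (T - t₂)) +
        VectorCalculus.kineticEnergy (u t₂) ≤ VectorCalculus.kineticEnergy (u t)
      linarith
    have hcont : Tendsto (fun t₂ => K * (Real.sqrt (T - t) - Real.sqrt (T - t₂)) + E t₂) (𝓝[<] T)
        (𝓝 (K * (Real.sqrt (T - t) - Real.sqrt (T - T)) + sInf (E '' Ioo 0 T))) := by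
      refine Tendsto.add ?_ hlim
      have h1 : Continuous fun t₂ : ℝ => K * (Real.sqrt (T - t) - Real.sqrt (T - t₂)) :=
        continuous_const.mul (continuous_const.sub ((continuous_const.sub continuous_id).sqrt))
      exact (h1.tendsto T).mono_left nhdsWithin_le_nhds
    have hle := le_of_tendsto hcont hev
    rw [sub_self, Real.sqrt_zero, sub_zero] at hle
    linarith

/-! ### FLOOR, WITNESS form: the crux class (the constant `c` is that of `enstrophy_rate_of_isMaximalSmoothSolution`) -/

/-- **THE DRAIN LAW for witnesses of the crux class.** With `c > 0` the absolute constant of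
`enstrophy_rate_of_isMaximalSmoothSolution` (Leray's): for every witness `(ν, T, u, p)` of the crux class of
`CertifiedBlowupAxisymBlowup` and all `0 ≤ t₁ < t₂ ≤ T`, `2c ν^{5/2}(√(T − t₁) − √(T − t₂)) ≤ E(u t₁) − E(u t₂)`.
[cite: Leray1934, §20 (3.12) p. 225; RobinsonRodrigoSadowski2016, Cor. 6.9 and Lemma 6.14] -/
theorem witness_energy_sub_ge : ∃ c : ℝ, 0 < c ∧ ∀ {ν T : ℝ}
    {u : ℝ → EuclideanSpace ℝ (Fin 3) → EuclideanSpace ℝ (Fin 3)} {p : ℝ → EuclideanSpace ℝ (Fin 3) → ℝ},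
    0 < ν → 0 < T → IsMaximalSmoothSolution ν 0 u p T → IsLerayHopfOn T ν 0 (u 0) u →
    HasRapidSpatialDecay (u 0) → IsAxisymmetric (u 0) → ∀ ⦃t₁ t₂ : ℝ⦄, 0 ≤ t₁ → t₁ < t₂ → t₂ ≤ T →
      2 * c * ν ^ (5 / 2 : ℝ) * (Real.sqrt (T - t₁) - Real.sqrt (T - t₂)) ≤
        VectorCalculus.kineticEnergy (u t₁) - VectorCalculus.kineticEnergy (u t₂) := by
  obtain ⟨c, hc, hrate⟩ := enstrophy_rate_of_isMaximalSmoothSolution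
  exact ⟨c, hc, fun {ν T u p} hν hT hmax hLH hdec haxi t₁ t₂ ht₁ h12 ht₂ =>
    energy_sub_ge_of_rate hν hmax.1 hLH hc.le (hrate hν hT hmax hLH hdec haxi) ht₁ h12 ht₂⟩

/-- **ENERGY FLOOR for witnesses: `2c ν^{5/2} √(T − t) ≤ E(u t) − E(u T) ≤ E(u t)` for every `t ∈ [0, T)`** — the last
`2c ν^{5/2}√(T − t)` of kinetic energy above the terminal slice is dissipated inside `[t, T)`; at `t = 0` this is the
tree's lifespan cap `ν⁵ T ≤ C E(u 0)²`. [cite: Leray1934, §34 p. 245 and §20 (3.12)] -/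
theorem witness_kineticEnergy_ge_sqrt : ∃ c : ℝ, 0 < c ∧ ∀ {ν T : ℝ}
    {u : ℝ → EuclideanSpace ℝ (Fin 3) → EuclideanSpace ℝ (Fin 3)} {p : ℝ → EuclideanSpace ℝ (Fin 3) → ℝ},
    0 < ν → 0 < T → IsMaximalSmoothSolution ν 0 u p T → IsLerayHopfOn T ν 0 (u 0) u →
    HasRapidSpatialDecay (u 0) → IsAxisymmetric (u 0) → ∀ t ∈ Ico 0 T,
      2 * c * ν ^ (5 / 2 : ℝ) * Real.sqrt (T - t) ≤
          VectorCalculus.kineticEnergy (u t) - VectorCalculus.kineticEnergy (u T) ∧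
        2 * c * ν ^ (5 / 2 : ℝ) * Real.sqrt (T - t) ≤ VectorCalculus.kineticEnergy (u t) := by
  obtain ⟨c, hc, hrate⟩ := enstrophy_rate_of_isMaximalSmoothSolution
  refine ⟨c, hc, fun {ν T u p} hν hT hmax hLH hdec haxi t ht => ?_⟩
  have hler := hrate hν hT hmax hLH hdec haxi
  exact ⟨energy_sub_terminal_ge_of_rate hν hmax.1 hLH hc.le hler ht,
    kineticEnergy_ge_sqrt_of_rate hν hmax.1 hLH hc.le hler ht⟩

/-- **NO ENERGY PLATEAU for witnesses**: the kinetic energy of every witness of the crux class is STRICTLY decreasing on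
`[0, T]`. ZONE-Z1 READING: a candidate whose printed energy is constant on a late window is outside the class.
[cite: Leray1934, §20 (3.12) and §31 (5.2)] -/
theorem witness_kineticEnergy_strictAntiOn (hν : 0 < ν) (hT : 0 < T) (hmax : IsMaximalSmoothSolution ν 0 u p T)
    (hLH : IsLerayHopfOn T ν 0 (u 0) u) (hdec : HasRapidSpatialDecay (u 0)) (haxi : IsAxisymmetric (u 0)) :
    StrictAntiOn (fun t => VectorCalculus.kineticEnergy (u t)) (Icc 0 T) := by
  obtain ⟨c, hc, hrate⟩ := enstrophy_rate_of_isMaximalSmoothSolution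
  exact kineticEnergy_strictAntiOn_of_rate hν hmax.1 hLH hc (hrate hν hT hmax hLH hdec haxi)

/-- **THE ENERGY DRAIN LAW for witnesses (limit form).** With `c > 0` the absolute constant of
`enstrophy_rate_of_isMaximalSmoothSolution`: for every witness `(ν, T, u, p)` of the crux class of
`CertifiedBlowupAxisymBlowup` there is a terminal energy level `E_∞` with `E(u T) ≤ E_∞ ≤ E(u t)` on `[0, T)`,
`E(u t) → E_∞` as `t → T⁻`, and **`2c ν^{5/2} √(T − t) ≤ E(u t) − E_∞` for every `t ∈ [0, T)`** (so `E(u t) − E_∞`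
is squeezed between `2c ν^{5/2}√(T − t)` and itself `→ 0`; the tail dissipation obeys
`2c ν^{5/2}√(T − t) ≤ ν∫_t^T∫|∇u|²_F ≤ E(u t) − E(u T)` by `window_dissipation_ge_of_rate` and `dissipation_le_energy_sub`).
ZONE-Z1 READING (K-audit hook): the dimensionless drain `(E(t) − E(T⁻))/(ν^{5/2}√(T − t))` of a candidate's printed
energy curve must stay above an absolute constant up to the claimed `T`. [cite: Leray1934, §20 (3.12) p. 225 and §31 (5.2); RobinsonRodrigoSadowski2016, Cor. 6.9 and Lemma 6.14] -/
theorem witness_energy_limit : ∃ c : ℝ, 0 < c ∧ ∀ {ν T : ℝ}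
    {u : ℝ → EuclideanSpace ℝ (Fin 3) → EuclideanSpace ℝ (Fin 3)} {p : ℝ → EuclideanSpace ℝ (Fin 3) → ℝ},
    0 < ν → 0 < T → IsMaximalSmoothSolution ν 0 u p T → IsLerayHopfOn T ν 0 (u 0) u →
    HasRapidSpatialDecay (u 0) → IsAxisymmetric (u 0) →
      ∃ Einf : ℝ, VectorCalculus.kineticEnergy (u T) ≤ Einf ∧
        (∀ t ∈ Ico 0 T, Einf ≤ VectorCalculus.kineticEnergy (u t)) ∧
        Tendsto (fun t => VectorCalculus.kineticEnergy (u t)) (𝓝[<] T) (𝓝 Einf) ∧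
        ∀ t ∈ Ico 0 T, 2 * c * ν ^ (5 / 2 : ℝ) * Real.sqrt (T - t) ≤ VectorCalculus.kineticEnergy (u t) - Einf := by
  obtain ⟨c, hc, hrate⟩ := enstrophy_rate_of_isMaximalSmoothSolution
  exact ⟨c, hc, fun {ν T u p} hν hT hmax hLH hdec haxi =>
    energy_limit_of_rate hν hT hmax.1 hLH hc.le (hrate hν hT hmax hLH hdec haxi)⟩

end Summit.NavierStokesRegularity.NavierStokesRegularity.Theorems.CertifiedBlowupAxisymBlowup.EnergyDrain

end
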